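import Summits.NavierStokesRegularity.NavierStokesRegularity.Theorems.PoloidalWindowDoorPoloidalWindowRigidityZShockCompactDisturbance
import Summits.NavierStokesRegularity.NavierStokesRegularity.Theorems.PoloidalWindowDoorPoloidalWindowRigidityZShockQuietTools
import HarnessLib

/-!
# Crux K2 `PoloidalWindowRigidity` (stmt-NavierStokesRegularity-19708), line `z_shock` — one-ended sign lemmas for the Riccati law
# `q' = −b q²` (tools for R2 without sign hypothesis with two different end states)

`--supports stmt-NavierStokesRegularity-19708 --as helper` (leafhand-ns-poloidalwindowdoor-3 g3, cell decomp-ns, 2026-08-31).  Class-free,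
Mathlib + two tree tool files.  **No stub and no summit is closed by this file; Navier–Stokes regularity is NOT proved here (rung 0).**

For a never-vanishing two-sided solution of `q' = −b q²` (John's weighted forward gradient along a loaded characteristic,
`…ZShockLoadedCharacteristics.johnGradient_hasDerivAt`), the sign of `q` is decided by the sign of the coefficient near EITHER end:
* `riccati_pos_of_fwd_pos` — `b ≥ b₀ > 0` on `[T, ∞)` ⇒ `q > 0` everywhere (`1/q` increases to `+∞` ahead, and `q` keeps one sign);
* `riccati_neg_of_fwd_neg` — `b ≤ −b₀` on `[T, ∞)` ⇒ `q < 0`;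
* `riccati_neg_of_bwd_pos` — `b ≥ b₀` on `(−∞, S]` ⇒ `q < 0` (`1/q → −∞` behind);
* `riccati_pos_of_bwd_neg` — `b ≤ −b₀` on `(−∞, S]` ⇒ `q > 0`.
So along a loaded forward characteristic `sign r_x = sign κ'(v₊) = −sign κ'(v₋)` whenever the limiting values `v±` of `w` at the two
ends are non-degenerate (sequel `…ZShockTwoStates`). [folklore]
-/

noncomputable section

namespace Summit.NavierStokesRegularity.NavierStokesRegularity.Theorems.PoloidalWindowDoorPoloidalWindowRigidityZShockOneEndedTools

-- the summit and its single sub-problem share the name (CONVENTIONS §1)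
set_option linter.dupNamespace false

open Set Filter Topology Function Metric
open Summit.NavierStokesRegularity.NavierStokesRegularity.Theorems.PoloidalWindowDoorPoloidalWindowRigidityZShockCompactDisturbance
open Summit.NavierStokesRegularity.NavierStokesRegularity.Theorems.PoloidalWindowDoorPoloidalWindowRigidityZShockQuietTools

variable {q b : ℝ → ℝ} {b₀ T S : ℝ}

/-- `1/q` has derivative `b` when `q' = −b q²` and `q ≠ 0`. [folklore] -/
theorem inv_hasDerivAt (hq : ∀ z, HasDerivAt q (-(b z * q z ^ 2)) z) (hne : ∀ z, q z ≠ 0) (z : ℝ) :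
    HasDerivAt (fun y => (q y)⁻¹) (b z) z := by
  have hz := hne z
  refine ((hq z).inv hz).congr_deriv ?_
  field_simp

/-- **Coefficient `≥ b₀ > 0` ahead ⇒ `q > 0` everywhere.** [folklore] -/
theorem riccati_pos_of_fwd_pos (hq : ∀ z, HasDerivAt q (-(b z * q z ^ 2)) z) (hne : ∀ z, q z ≠ 0) (hb₀ : 0 < b₀)
    (hfwd : ∀ z, T ≤ z → b₀ ≤ b z) : ∀ z, 0 < q z := by
  have hψ := inv_hasDerivAt hq hne
  have hqc : Continuous q := continuous_iff_continuousAt.2 fun z => (hq z).continuousAt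
  set z₁ : ℝ := T + (|(q T)⁻¹| + 1) / b₀ with hz₁
  have hT : T < z₁ := by
    have : 0 < (|(q T)⁻¹| + 1) / b₀ := by positivity
    rw [hz₁]; linarith
  have hpos : 0 < (q z₁)⁻¹ := by
    have h := slope_ge_of_deriv_ge hψ hT (fun z hz => hfwd z hz.1.le)
    have h2 : b₀ * (z₁ - T) = |(q T)⁻¹| + 1 := by rw [hz₁]; field_simp; ring
    linarith [neg_abs_le (q T)⁻¹]
  have hq₁ : 0 < q z₁ := inv_pos.1 hpos
  intro z
  have h := mul_pos_of_ne_zero hqc hne z z₁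
  by_contra hneg
  have : q z < 0 := lt_of_le_of_ne (not_lt.1 hneg) (hne z)
  nlinarith

/-- **Coefficient `≤ −b₀ < 0` ahead ⇒ `q < 0` everywhere** (`−q` solves the law with coefficient `−b`). [folklore] -/
theorem riccati_neg_of_fwd_neg (hq : ∀ z, HasDerivAt q (-(b z * q z ^ 2)) z) (hne : ∀ z, q z ≠ 0) (hb₀ : 0 < b₀)
    (hfwd : ∀ z, T ≤ z → b z ≤ -b₀) : ∀ z, q z < 0 := by
  have hQ : ∀ z, HasDerivAt (fun z => -q z) (-((-b z) * (-q z) ^ 2)) z := fun z =>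
    (hq z).neg.congr_deriv (by ring)
  have h := riccati_pos_of_fwd_pos (q := fun z => -q z) (b := fun z => -b z) hQ (fun z => neg_ne_zero.2 (hne z)) hb₀
    (fun z hz => by linarith [hfwd z hz])
  intro z
  linarith [h z]

/-- **Coefficient `≥ b₀ > 0` behind ⇒ `q < 0` everywhere** (`1/q → −∞` as `z → −∞`). [folklore] -/
theorem riccati_neg_of_bwd_pos (hq : ∀ z, HasDerivAt q (-(b z * q z ^ 2)) z) (hne : ∀ z, q z ≠ 0) (hb₀ : 0 < b₀)
    (hbwd : ∀ z, z ≤ S → b₀ ≤ b z) : ∀ z, q z < 0 := by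
  have hψ := inv_hasDerivAt hq hne
  have hqc : Continuous q := continuous_iff_continuousAt.2 fun z => (hq z).continuousAt
  set z₁ : ℝ := S - (|(q S)⁻¹| + 1) / b₀ with hz₁
  have hS : z₁ < S := by
    have : 0 < (|(q S)⁻¹| + 1) / b₀ := by positivity
    rw [hz₁]; linarith
  have hneg : (q z₁)⁻¹ < 0 := by
    have h := slope_ge_of_deriv_ge hψ hS (fun z hz => hbwd z hz.2.le)
    have h2 : b₀ * (S - z₁) = |(q S)⁻¹| + 1 := by rw [hz₁]; field_simp; ring
    linarith [le_abs_self (q S)⁻¹]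
  have hq₁ : q z₁ < 0 := inv_lt_zero.1 hneg
  intro z
  have h := mul_pos_of_ne_zero hqc hne z z₁
  by_contra hpos
  have : 0 < q z := lt_of_le_of_ne (not_lt.1 hpos) (fun h' => hne z h'.symm)
  nlinarith

/-- **Coefficient `≤ −b₀ < 0` behind ⇒ `q > 0` everywhere.** [folklore] -/
theorem riccati_pos_of_bwd_neg (hq : ∀ z, HasDerivAt q (-(b z * q z ^ 2)) z) (hne : ∀ z, q z ≠ 0) (hb₀ : 0 < b₀)
    (hbwd : ∀ z, z ≤ S → b z ≤ -b₀) : ∀ z, 0 < q z := by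
  have hQ : ∀ z, HasDerivAt (fun z => -q z) (-((-b z) * (-q z) ^ 2)) z := fun z =>
    (hq z).neg.congr_deriv (by ring)
  have h := riccati_neg_of_bwd_pos (q := fun z => -q z) (b := fun z => -b z) hQ (fun z => neg_ne_zero.2 (hne z)) hb₀
    (fun z hz => by linarith [hbwd z hz])
  intro z
  linarith [h z]

end Summit.NavierStokesRegularity.NavierStokesRegularity.Theorems.PoloidalWindowDoorPoloidalWindowRigidityZShockOneEndedTools

end
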